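import Summits.Ventures.CertifiedQuantumChemistry.Statement
import Summits.Ventures.CertifiedQuantumChemistry.Rows.GMatrixRelaxationKernel
import Literature.MathematicalPhysics.QuantumChemistry.OnePositivityFromTwoPositivity
import Literature.LinearAlgebra.Matrix.HermitianCfcDiagonalForm
import Summits.Ventures.CertifiedQuantumChemistry.Hamiltonians.Tables
import HarnessLib

/-!
# Ventures/CertifiedQuantumChemistry — Rows/V2RDMDualKernelTerms.lean: raw-moment descriptors, linear forms and their values, canonicalisation (Hermiticity / antisymmetry)

HONEST FRAMING (verbatim): certified bounds for a stated model Hamiltonian in a stated basis; not a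
claim about the real molecule beyond that model.

PART OF `Rows/V2RDMDualKernel.lean` (rdm-A g61, KERNEL-SDP): the kernel-replayed v2RDM dual SDP certificate ⇒ `LowerRow`.
The development is split into `Rows/V2RDMDualKernelTerms.lean` → `…Residual.lean` → `…Blocks.lean`, `…Pack.lean` → `Rows/V2RDMDualKernel.lean`
(the entry points `lowerRow_of_check` / `lowerRow_of_staged` and the full account live in the last file); one namespace
`Summit.Ventures.CertifiedQuantumChemistry.V2RDMDual` throughout, so declaration names do not depend on the file split.
-/

namespace Summit.Ventures.CertifiedQuantumChemistry

open Matrix Finset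
open scoped ComplexOrder
open Literature.MathematicalPhysics.QuantumLattice Literature.MathematicalPhysics.QuantumChemistry

namespace V2RDMDual

/-! ## Two list-sum bridges -/

/-- A `List.finRange` sum is the corresponding `Finset.univ` sum. -/
theorem list_sum_finRange {β : Type*} [AddCommMonoid β] {m : ℕ} (f : Fin m → β) :
    ((List.finRange m).map f).sum = ∑ i, f i := by
  rw [Fin.sum_univ_def]

/-- A `List.range` sum is the corresponding `Finset.range` sum. -/
theorem list_sum_range {β : Type*} [AddCommMonoid β] (f : ℕ → β) (n : ℕ) :
    ((List.range n).map f).sum = ∑ i ∈ Finset.range n, f i := by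
  induction n with
  | zero => simp
  | succ n ih => rw [List.range_succ, List.map_append, List.sum_append, ih, Finset.sum_range_succ]; simp

/-- A list of nonpositive reals has nonpositive sum. -/
theorem list_sum_nonpos {l : List ℝ} (h : ∀ x ∈ l, x ≤ 0) : l.sum ≤ 0 := by
  induction l with
  | nil => simp
  | cons a l ih =>
    rw [List.sum_cons]
    have ha := h a (by simp)
    have hl := ih fun x hx => h x (by simp [hx])
    linarith

/-! ## Raw moment descriptors, terms, values -/

/-- A raw moment of an abstract pair `(γ, Γ)` over `2k` spin orbitals numbered `x = p + kσ`
(`σ = 0` for `x < k`, `σ = 1` for `k ≤ x < 2k`): `one x y ↦ Re γ_{x,y}`, `two x₁ x₂ y₁ y₂ ↦ Re Γ_{(x₁,x₂),(y₁,y₂)}`. -/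
inductive Desc where
  | one (x y : ℕ)
  | two (x₁ x₂ y₁ y₂ : ℕ)
  deriving DecidableEq, Repr, Inhabited

/-- A term of a linear form: rational coefficient times a raw moment. -/
abbrev Term := ℚ × Desc

/-- One-matrix and two-matrix types over the spin orbitals of `k` spatial orbitals. -/
abbrev M1 (k : ℕ) := Matrix (Orb (Fin k)) (Orb (Fin k)) ℂ
/-- see `M1`. -/
abbrev M2 (k : ℕ) := Matrix (Orb (Fin k) × Orb (Fin k)) (Orb (Fin k) × Orb (Fin k)) ℂ

section Semantics

variable (k : ℕ) [NeZero k]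

/-- The spin orbital numbered `x`: spatial index `x % k`, spin `α` if `x < k` else `β`. -/
def so (x : ℕ) : Orb (Fin k) :=
  orb ⟨x % k, Nat.mod_lt _ (Nat.pos_of_neZero k)⟩ (if x < k then 0 else 1)

variable (γ : M1 k) (Γ : M2 k)

/-- The value of a raw moment at `(γ, Γ)`. -/
def Desc.val : Desc → ℝ
  | .one x y => (γ (so k x) (so k y)).re
  | .two x₁ x₂ y₁ y₂ => (Γ (so k x₁, so k x₂) (so k y₁, so k y₂)).re

/-- The value of a list of terms (a linear form without constant). -/
def termsVal (l : List Term) : ℝ := (l.map fun t => (t.1 : ℝ) * Desc.val k γ Γ t.2).sum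

variable {k γ Γ}

/-- The empty form evaluates to `0`. -/
@[simp] theorem termsVal_nil : termsVal k γ Γ [] = 0 := by simp [termsVal]

/-- Evaluation of a form peels off its head term. -/
@[simp] theorem termsVal_cons (t : Term) (l : List Term) :
    termsVal k γ Γ (t :: l) = (t.1 : ℝ) * Desc.val k γ Γ t.2 + termsVal k γ Γ l := by
  simp [termsVal]

/-- Evaluation is additive under concatenation. -/
@[simp] theorem termsVal_append (l l' : List Term) :
    termsVal k γ Γ (l ++ l') = termsVal k γ Γ l + termsVal k γ Γ l' := by
  simp [termsVal, List.map_append, List.sum_append]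

/-- Evaluation is invariant under permutation of the terms. -/
theorem termsVal_perm {l l' : List Term} (h : l.Perm l') : termsVal k γ Γ l = termsVal k γ Γ l' := by
  unfold termsVal; exact (h.map _).sum_eq

/-- Evaluation of a `flatMap` is the sum of the evaluations of the pieces. -/
theorem termsVal_flatMap {α : Type*} (l : List α) (f : α → List Term) :
    termsVal k γ Γ (l.flatMap f) = (l.map fun a => termsVal k γ Γ (f a)).sum := by
  induction l with
  | nil => simp
  | cons a l ih => simp [List.flatMap_cons, ih]

/-- Scaling a term. -/
def scale (w : ℚ) (t : Term) : Term := (w * t.1, t.2)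

/-- Scaling every coefficient by `w` scales the value by `w`. -/
theorem termsVal_map_scale (w : ℚ) (l : List Term) :
    termsVal k γ Γ (l.map (scale w)) = (w : ℝ) * termsVal k γ Γ l := by
  induction l with
  | nil => simp
  | cons t l ih => simp only [List.map_cons, termsVal_cons, ih, scale]; push_cast; ring

/-- Emit the terms `c · d` for `d ∈ ds`, nothing if `c = 0`. -/
def emit (c : ℚ) (ds : List Desc) : List Term := if c = 0 then [] else ds.map fun d => (c, d)

/-- The value of `emit c ds`: `c` times the sum of the moment values. -/
theorem termsVal_emit (c : ℚ) (ds : List Desc) :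
    termsVal k γ Γ (emit c ds) = (c : ℝ) * (ds.map (Desc.val k γ Γ)).sum := by
  unfold emit
  split_ifs with h
  · simp [h]
  · induction ds with
    | nil => simp
    | cons d ds ih => simp only [List.map_cons, termsVal_cons, ih, List.sum_cons]; ring

/-! ### The spin-orbital numbering -/

/-- Numbers `p < k` are the `α` spin orbitals. -/
theorem so_fin0 (p : Fin k) : so k (p : ℕ) = orb p 0 := by
  unfold so
  have h : (⟨(p : ℕ) % k, Nat.mod_lt _ (Nat.pos_of_neZero k)⟩ : Fin k) = p := Fin.ext (Nat.mod_eq_of_lt p.isLt)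
  rw [h, if_pos p.isLt]

/-- Numbers `p + k` are the `β` spin orbitals. -/
theorem so_fin1 (p : Fin k) : so k ((p : ℕ) + k) = orb p 1 := by
  unfold so
  have h : (⟨((p : ℕ) + k) % k, Nat.mod_lt _ (Nat.pos_of_neZero k)⟩ : Fin k) = p :=
    Fin.ext (by rw [Fin.val_mk, Nat.add_mod_right, Nat.mod_eq_of_lt p.isLt])
  rw [h, if_neg (by omega)]

/-- The number of the spin orbital `(p, σ)`: `p + kσ`. -/
def xo (k : ℕ) (σ : Fin 2) (p : ℕ) : ℕ := p + k * σ

/-- `so` inverts the numbering `xo`. -/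
theorem so_xo (σ : Fin 2) (p : Fin k) : so k (xo k σ p) = orb p σ := by
  fin_cases σ
  · simpa [xo] using so_fin0 p
  · simpa [xo, Nat.mul_one] using so_fin1 p

/-- The spin-orbital numbering is injective below `2k`. -/
theorem so_inj {x y : ℕ} (hx : x < 2 * k) (hy : y < 2 * k) (h : so k x = so k y) : x = y := by
  unfold so orb at h
  have h' := toLex.injective h
  simp only [Prod.mk.injEq, Fin.mk.injEq] at h'
  obtain ⟨hm, hs⟩ := h'
  have kpos : 0 < k := Nat.pos_of_neZero k
  by_cases hxk : x < k <;> by_cases hyk : y < k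
  · rwa [Nat.mod_eq_of_lt hxk, Nat.mod_eq_of_lt hyk] at hm
  · rw [if_pos hxk, if_neg hyk] at hs; exact absurd hs (by decide)
  · rw [if_neg hxk, if_pos hyk] at hs; exact absurd hs (by decide)
  · rw [Nat.mod_eq_sub_mod (by omega), Nat.mod_eq_of_lt (by omega),
      Nat.mod_eq_sub_mod (show k ≤ y by omega), Nat.mod_eq_of_lt (by omega)] at hm
    omega

/-- Two numbers below `2k` name the same spin orbital iff they are equal. -/
theorem so_eq_iff {x y : ℕ} (hx : x < 2 * k) (hy : y < 2 * k) : so k x = so k y ↔ x = y :=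
  ⟨so_inj hx hy, fun h => h ▸ rfl⟩

/-! ## Canonicalisation by Hermiticity and antisymmetry -/

section Canon

variable {N : ℕ}

/-- Hermiticity of `γ`: the real part of a one-body moment is symmetric in its indices. -/
theorem val_one_swap (h : γ.IsHermitian) (x y : ℕ) :
    Desc.val k γ Γ (.one y x) = Desc.val k γ Γ (.one x y) := by
  simp only [Desc.val]
  rw [← h.apply (so k y) (so k x), Complex.star_def, Complex.conj_re]

/-- Antisymmetry of `Γ` in the first index pair, on real parts. -/
theorem val_two_swap12 (h : IsDQGFeasible N γ Γ) (x₁ x₂ y₁ y₂ : ℕ) :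
    Desc.val k γ Γ (.two x₂ x₁ y₁ y₂) = -Desc.val k γ Γ (.two x₁ x₂ y₁ y₂) := by
  simp only [Desc.val]; rw [h.swap_fst, Complex.neg_re]

/-- Antisymmetry of `Γ` in the second index pair, on real parts. -/
theorem val_two_swap34 (h : IsDQGFeasible N γ Γ) (x₁ x₂ y₁ y₂ : ℕ) :
    Desc.val k γ Γ (.two x₁ x₂ y₂ y₁) = -Desc.val k γ Γ (.two x₁ x₂ y₁ y₂) := by
  simp only [Desc.val]; rw [h.swap_snd, Complex.neg_re]

/-- A two-body moment with a repeated creation index vanishes (Pauli). -/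
theorem val_two_eq12 (h : IsDQGFeasible N γ Γ) (x y₁ y₂ : ℕ) : Desc.val k γ Γ (.two x x y₁ y₂) = 0 := by
  have h1 := val_two_swap12 (k := k) h x x y₁ y₂
  linarith

/-- A two-body moment with a repeated annihilation index vanishes (Pauli). -/
theorem val_two_eq34 (h : IsDQGFeasible N γ Γ) (x₁ x₂ y : ℕ) : Desc.val k γ Γ (.two x₁ x₂ y y) = 0 := by
  have h1 := val_two_swap34 (k := k) h x₁ x₂ y y
  linarith

/-- Hermiticity of `Γ`: the real part of a two-body moment is symmetric under exchanging the index pairs. -/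
theorem val_two_herm (h : IsDQGFeasible N γ Γ) (x₁ x₂ y₁ y₂ : ℕ) :
    Desc.val k γ Γ (.two y₁ y₂ x₁ x₂) = Desc.val k γ Γ (.two x₁ x₂ y₁ y₂) := by
  simp only [Desc.val]
  rw [← h.d_psd.1.apply (so k y₁, so k y₂) (so k x₁, so k x₂), Complex.star_def, Complex.conj_re]

/-- Order the two pairs of a `two` descriptor (Hermiticity). -/
def canonP (c : ℚ) (u₁ u₂ w₁ w₂ : ℕ) : Term :=
  if u₁ < w₁ ∨ (u₁ = w₁ ∧ u₂ ≤ w₂) then (c, .two u₁ u₂ w₁ w₂) else (c, .two w₁ w₂ u₁ u₂)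

/-- Canonical form of a term: `one x y` with `x ≤ y`; `two` with sorted pairs (sign), pairs ordered,
coefficient `0` on a repeated index. -/
def canon : Term → Term
  | (c, .one x y) => if x ≤ y then (c, .one x y) else (c, .one y x)
  | (c, .two x₁ x₂ y₁ y₂) =>
    if x₁ = x₂ ∨ y₁ = y₂ then (0, .one 0 0)
    else if x₁ < x₂ then (if y₁ < y₂ then canonP c x₁ x₂ y₁ y₂ else canonP (-c) x₁ x₂ y₂ y₁)
    else (if y₁ < y₂ then canonP (-c) x₂ x₁ y₁ y₂ else canonP c x₂ x₁ y₂ y₁)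

/-- The value of a single term. -/
def termVal (t : Term) : ℝ := (t.1 : ℝ) * Desc.val k γ Γ t.2

/-- `canonP` preserves the value of a two-body term (Hermiticity). -/
theorem termVal_canonP (h : IsDQGFeasible N γ Γ) (c : ℚ) (u₁ u₂ w₁ w₂ : ℕ) :
    termVal (k := k) (γ := γ) (Γ := Γ) (canonP c u₁ u₂ w₁ w₂) = (c : ℝ) * Desc.val k γ Γ (.two u₁ u₂ w₁ w₂) := by
  unfold canonP
  split_ifs
  · rfl
  · simp only [termVal]; rw [val_two_herm h]

/-- Canonicalisation preserves the value of a term on the DQG-feasible set. -/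
theorem termVal_canon (h : IsDQGFeasible N γ Γ) (t : Term) :
    termVal (k := k) (γ := γ) (Γ := Γ) (canon t) = termVal (k := k) (γ := γ) (Γ := Γ) t := by
  obtain ⟨c, d⟩ := t
  cases d with
  | one x y =>
    simp only [canon]
    split_ifs
    · rfl
    · simp only [termVal]; rw [val_one_swap h.herm_one]
  | two x₁ x₂ y₁ y₂ =>
    simp only [canon]
    split_ifs with h0 hx hy hy'
    · simp only [termVal]
      rcases h0 with h0 | h0
      · subst h0; rw [val_two_eq12 h]; simp
      · subst h0; rw [val_two_eq34 h]; simp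
    · exact termVal_canonP h c _ _ _ _
    · rw [termVal_canonP h, val_two_swap34 h]; simp [termVal]
    · rw [termVal_canonP h, val_two_swap12 h]; simp [termVal]
    · rw [termVal_canonP h, val_two_swap12 h, val_two_swap34 h]; simp [termVal]

/-- A form evaluates to the sum of its term values. -/
theorem termsVal_eq_sum_termVal (l : List Term) : termsVal k γ Γ l = (l.map (termVal (k := k) (γ := γ) (Γ := Γ))).sum := rfl

/-- Canonicalising every term preserves the value of a form. -/
theorem termsVal_map_canon (h : IsDQGFeasible N γ Γ) (l : List Term) :
    termsVal k γ Γ (l.map canon) = termsVal k γ Γ l := by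
  induction l with
  | nil => simp
  | cons t l ih =>
    rw [List.map_cons, termsVal_cons, termsVal_cons, ih]
    have := termVal_canon (k := k) h t
    simp only [termVal] at this
    rw [this]

end Canon

end Semantics

end V2RDMDual

end Summit.Ventures.CertifiedQuantumChemistry
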